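import Summits.QuantumFields.BalabanUV.T4Continuum.Spine.NE1p.DressedStabilityOfCanonicalSliceWinSchedules
import Summits.QuantumFields.BalabanUV.T4Continuum.Spine.NE1p.DressedTowerWitnessSliceEnd
import Summits.QuantumFields.BalabanUV.T4Continuum.Spine.NE1p.DressedCellNecessity

/-!
# T⁴ programme, spine estimate NE1′ (node O3b/H2) — A TERMINAL FACE FIRES BY REUSE, part 1: the integer window against the cell
# constant, the integer-`L` DATA on row W7's function-level toy (anchoring on `ℕ⁴`, housed met components, live families below the
# cutoff, absorption-free births) and the booking convention met by a bounded, attained increment set (swarm item W11r «the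
# canonical terminal face fires on `towerM` unchanged at every integer L ∈ [81,120] with the H2 dictionary live» of
# `t4/formal/NE1p/LEAVES.md`, typer R-T60 (i); INTENT CLAIMS.log l.11450, READY-FILE OFFER l.11576)

Cell `pub-balaban`, sub-cell `t4`, BINDER-OWNERS row NE1′, formalisation crew `b2b-balaban-t4-ne1p-formalise-*`, seat `…-leaf-02`
(gen 4; lineage rows S5b∕W3∕S6b∕S3e∕S3i∕S5e∕S3j∕W8∕S3k.1∕S3l.1).  CREDIT (typer R-T58 (ii) ∕ R-T59 (iii) ∕ R-T60 (i)(d)): LF-4 is leaf-09-g3's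
located observation (CLAIMS.log l.11316); the reuse route was sized in this seat's INTENT l.11450, located independently by
leaf-07-g5 (l.11470 ∕ l.11541 — the budget-coupled threshold, row S3c.1 `DressedCellNecessityBudget`) and built independently a
second time by leaf-09-g4 (l.11604, draft `DressedTowerWitnessTerminal`, not filed — the route is confirmed twice in kernel); row
W11 «a terminal face fires» itself is leaf-03-g3's NEW least-integer toy (`L = 21`, `κ = 1∕100`, dictionary off) in
`DressedTerminalWitness{,End}`; this REUSE witness W11r is its sibling (live H2 dictionary at an integer `L`, no new toy).  ADDITIVE — imports leaf-09's row S3l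
`Spine/NE1p/DressedStabilityOfCanonicalSliceWinSchedules` (p215128: THE CANONICAL TERMINAL FACE; through it the anchoring format
`T4FeltGeometry.Anchoring` and row S5b's `fanout`∕`absorbAmplitude`), leaf-03's row W7 part 2 `Spine/NE1p/DressedTowerWitnessSliceEnd` (p214558; through it
W7 part 1 p214450 and W5 parts 1–2: the tower `towerM`, the schedule `Wm`, the carried functionals `FnM`, the dictionary exponent
`𝒬M`, the two-atom measures `flAt (atomW (k+1))`, the directions `dirW`∕`dirAtom`∕`dirNull`, and the binder lemmas `hslM`,
`FnM_succ`, `hQM`, `relGauge_pairs`, `hδfM`, `hδfwkM`, `hdefwkM`, `hrateM`, `hcmM`, `hDμM`, `hz₁M`, `hregM`, `realBaseAt_W`,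
`exponentSliceAt_M`, `mem_bddClass_flAt`, `aesm_flAt`) and leaf-07-g2's row S3c `Spine/NE1p/DressedCellNecessity` (p213339: the decided
enclosure `20.08 < e³ < 20.09`) ONLY; modifies nothing.  Part 2 (`DressedTerminalWitnessReuseEnd`) applies the face BY NAME.
(v1.1 DOCFIX-LOW, X74 INFO-3 ∕ typer R-T74 (vii): row S3c's holder and pid corrected in the sentence above; no declaration changed.)

WHY (leaf-09-g3's LOCATED OBSERVATION «NO EXISTING TOY CAN FIRE A TERMINAL FACE», CLAIMS.log l.11316, recorded as LF-4 by R-T56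
(h)).  The four terminal faces S3k∕S3k.1∕S3l∕S3l.1 read L-C off an ANCHORING with an INTEGER blocking factor (`Anch a K : Anchoring
(𝒯.B a K) 4 Lb`, `Lb : ℕ`, `hLb : (Lb : ℝ) = L`), whereas every function-level toy in the tree (W5∕W7∕W7c∕W9∕W10) runs at the cell
constant `LW := 2·alphaCell ½ = 6e³`, which is NOT an integer (`LW_window`: `120 < LW < 121`), and the one integer-`L` toy (W8,
this seat) carries no function-level data.  So the referee's (t5) non-vacuity column for the TERMINAL theorem was covered only in
two halves (W7c: S3h-2's With-form with `hS`∕`hcount`∕`hbirth`∕`hlin` supplied directly; W8: the suppliers' DATA shapes at the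
cell).  THIS FILE closes it JOINTLY, and WITHOUT re-instantiating any function-level datum.  KEY ARITHMETIC POINT.  The terminal face ties the blocking factor `L` to the function-level data ONLY through UPPER bounds at the
transverse rate `ψ = L⁻²` (`hδf`, `hrate`) and the birth decay `L⁻³` (`hβ`), and through the located largeness `hloc`; W7's data
decay at the cell constant's rates `LW⁻²`∕`LW⁻³`, which are DOMINATED by `L⁻²`∕`L⁻³` exactly when `L ≤ LW` (`psi_le_psiL`,
`tau_pow_le`), while `hloc`∕`hsmall` at the reused dictionary constant `c₀ = ¼ = m`, `N₀ = 1`, `A₀ = β₀ = 1` (forced at the cutoff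
`K = 0` by the absorption-free birth identity `2·gen = β`), `c̄ = 0`, `s̄⁰ = 0` need `3e³∕L ≤ ρ′` with `¼·(1 − ρ′)⁻¹ ≤ 1`, i.e.
`ρ′ ≤ ¾` and `L ≥ 4e³ ≈ 80.34`.  Hence the canonical terminal face fires on `towerM` at EVERY INTEGER `81 ≤ L ≤ 120` — and at no
integer `≤ 80` with these scalars (`eighty_blocks_excluded`), while W9's live action margin THE NUMBER `s̄⁰ = ½` would force
`ρ′ ≤ ½`, `L ≥ LW`, i.e. NO integer of the reuse window (`half_margin_needs_LW`) — recorded, not repaired: (w2-act) rides here as in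
W7 (`𝒜 ≡ 0`, `s ≡ 0`, DECLARED ≡ 0), (w5) as `creg ≡ 0` (DECLARED ≡ 0; W10's `c̄ > 0` tower has its own LW-sized budget),
absorption as `Sabs ≡ ∅` (DECLARED ∅; live at booking level in W3∕W8, at function level in leaf-04-g3's W13), the H2
dictionary `hQ`, the step law `hFn` and the source tie `hcm` LIVE with EQUALITY (W7), the births `hsl` LIVE, the (I4′) links LIVE.
* §1 the integer window against the cell constant: `LW = 6e³ ∈ (120, 121)`; for `81 ≤ Lb ≤ 120`: `Lb ≤ LW`, `LW⁻² ≤ Lb⁻²`,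
  `(LW⁻³)^K ≤ (Lb⁻³)^{K−j}`, the located largeness `locCell Lb 2 0 ½ = 3e³∕Lb ≤ ¾` and the window `¼·(1·1·(1−¾)⁻¹) ≤ 1 − 0` with
  EQUALITY (the dressed budget exactly spent); necessity `eighty_blocks_excluded`, `half_margin_needs_LW`.
* §2 the integer-`L` DATA on W7's booking `BM K`: the anchoring `anchM K Lb` on `ℕ⁴` (every domain the zero block, every cube centred
  at the zero block — `felt_under` for ANY `Lb`), multiplicity `mB = 1`, met components `compM` = the one cube of the current scale
  (volume `v = 1`), live families `SM K k b = {b}`, generations `SgM K k b = {(b,0)}` and dictionary exponent `𝒬T K k := 𝒬M K k`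
  AT AND BELOW THE CUTOFF and `∅`∕`0` above it (no cube lives above `K`, so `hhoused` forces the guard — W8's «none booked above the
  cutoff»; `hQ` stays an EQUATION at every `k`, `hFn` — only asked for `k+1 ≤ K` — is W7's `FnM_succ`); absorption-free births
  `Sabs ≡ ∅`, `A = 0`, dressing envelope `β K j := (LW⁻³)^K` with `2·gen b 0 = β K 0` EXACTLY (`habsM`).
* §3 the BOOKING CONVENTION replacing F-8 (row S8's `hne`∕`hsup`, stated with `Real.sSup`): for the affine functional
  `FnM K 0 k U = a_K·(U₀₀ + shift k)` and `rel := Eq`, an admissible pair `(U₀, U₁ = latMove U₀ p 1)` with `latN p ≤ δ_{k+1}` has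
  increment `a_K·‖p₀₀‖ ≤ a_K·δ_{k+1} = lin b 0 k` (`osc_le`), attained along `dirW (k+1)` (`osc_dirW`) — so the realised-increment set
  is BOUNDED ABOVE and contains the booked size: `lin ≤ sSup` by `le_csSup` (`hsupM`); `hne` by the same pair (`hneM`).
* §4–§5 are part 2 (`DressedTerminalWitnessReuseEnd`): S3l's three theorems BY NAME on `towerM` at every integer `81 ≤ Lb ≤ 120` —
  `dressedStabilityWith_towerM_integer` ∕ `dressedStability_towerM_integer` ∕ `dressedBudget_towerM_integer` — and the decided `Lb = 100`.

WHAT IT IS NOT.  Not an estimate; data and arithmetic for a joint-satisfiability certificate of the canonical terminal face's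
binder SHAPES on a DECIDED toy (labelled toy); nothing of Bałaban's densities or of [Balaban1989LargeFieldII] is encoded or asserted
(CONTEXT only); no `def … : Prop` (term∕data defs only: `anchM`, `compM`, `SM`, `SgM`, `𝒬T`); [folklore] toy kernel mathematics,
0 sorry, 0 citations used as facts.  It changes NOTHING about the walls.

HONEST FRAMING.  Rung (B)+1 bookkeeping on ONE finite four-torus of fixed physical size — NOT infinite volume, NOT a mass gap, NOT
OS on ℝ⁴, NOT the Clay problem, NOT summit progress.  Headline (c4): «non-vacuity of the TERMINAL face's SHAPES at an integer
blocking factor; NE1′ ⇐ the named binders, NOT proved, NOT printed; 0 binders instantiated on Bałaban's densities»; spine PROVED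
0∕9 unchanged.  HONEST DEPENDENCY: continuum YM on T⁴ ⇐ BetaPertH ∧ nine spine estimates (0/9 proved); BetaPertH ⇐ (D1) ∧ (D4) ∧
CAP+tail; G-an2-4 gates asym, D1 and NE2/3/4.
-/

noncomputable section

namespace Summit.QuantumFields.BalabanUV.T4Continuum.NE1p.DressedTerminalWitnessReuse

open MeasureTheory Set Metric Filter Finset
open scoped BigOperators
open Literature.MathematicalPhysics.QuantumFieldTheory.Balaban1983to89
open Literature.MathematicalPhysics.QuantumFieldTheory.Balaban1983to89.T4TermFormat
open Literature.MathematicalPhysics.QuantumFieldTheory.Balaban1983to89.T4TermFormat.Booking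
open Literature.MathematicalPhysics.QuantumFieldTheory.Balaban1983to89.T4FeltGeometry
open Literature.MathematicalPhysics.QuantumFieldTheory.Balaban1983to89.T4GatedBooking
open Literature.MathematicalPhysics.QuantumFieldTheory.Balaban1983to89.T4TrajectoryComparison
open Literature.MathematicalPhysics.QuantumFieldTheory.Balaban1983to89.T4TrajectoryModulus
open T4TrajectoryModulus (bondBall bondBall_add_mem bondBall_latMove_add_mem bondBall_diam)
open T4BlockTransport (Fld NDir latMove latN Site norm_dir_le)
open T4BirthChartTransport (GaugeInvariant BirthSlice RelGauge)
open T4TrajectoryDensity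
open Summit.QuantumFields.BalabanUV.T4Continuum.T4TrajectoryDensityDressed
open Summit.QuantumFields.BalabanUV.T4Continuum.T4TrajectoryDensityWitness
open Summit.QuantumFields.BalabanUV.T4Continuum.NE1p.DressedRoot
open Summit.QuantumFields.BalabanUV.T4Continuum.NE1p.DressedUniformConstants
open Summit.QuantumFields.BalabanUV.T4Continuum.NE1p.DressedWindowScheduleWin
open Summit.QuantumFields.BalabanUV.T4Continuum.NE1p.DressedWindowScheduleModWin
open Summit.QuantumFields.BalabanUV.T4Continuum.NE1p.DressedAbsorptionWindow
open Summit.QuantumFields.BalabanUV.T4Continuum.NE1p.DressedTowerWitness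
open Summit.QuantumFields.BalabanUV.T4Continuum.NE1p.DressedTowerWitnessSlice
open Summit.QuantumFields.BalabanUV.T4Continuum.NE1p.DressedTransportAssembledModData
open Summit.QuantumFields.BalabanUV.T4Continuum.NE1p.DressedCellNecessity

/-! ## §1 The integer window against the cell constant [arith] -/

/-- W5's cell constant is `6e³`: `LW = 2·e³·(1 + 4·½)`. [folklore] -/
theorem LW_eq : LW = 6 * Real.exp 3 := by
  unfold LW alphaCell; ring

/-- **THE CELL CONSTANT IS NOT AN INTEGER** [decided numeral]: `120 < LW < 121` (`6·20.08 = 120.48`, `6·20.09 = 120.54`) — so NO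
toy running at `L = LW` instantiates the terminal faces' `hLb : (Lb : ℝ) = L`, and `120 = ⌊LW⌋`. [folklore] -/
theorem LW_window : (120 : ℝ) < LW ∧ LW < 121 := by
  rw [LW_eq]
  exact ⟨by linarith [exp_three_gt_20_08], by linarith [exp_three_lt_20_09]⟩

section IntegerWindow

variable {Lb : ℕ} (h81 : 81 ≤ Lb) (h120 : Lb ≤ 120)
include h81 in
/-- [arith] [folklore] The blocking factor is positive. -/
theorem natL_pos : (0 : ℝ) < Lb := by linarith [show (81 : ℝ) ≤ Lb by exact_mod_cast h81]
include h81 in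
/-- [arith] [folklore] `1 ≤ Lb` (the face's `hL`). -/
theorem one_le_natL : (1 : ℝ) ≤ Lb := by linarith [show (81 : ℝ) ≤ Lb by exact_mod_cast h81]
include h120 in
/-- **THE REUSE CONDITION** [arith]: an integer of the window is below the cell constant, `Lb ≤ 120 < LW`. [folklore] -/
theorem natL_le_LW : (Lb : ℝ) ≤ LW := by linarith [show (Lb : ℝ) ≤ 120 by exact_mod_cast h120, LW_window.1]

include h81 h120 in
/-- **RATE DOMINATION** [arith]: W7's transverse rate is below the face's, `LW⁻² ≤ Lb⁻²` — so every defect bound of W7 at rate `LW⁻²`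
(`hδfM`, `hrateM`) is a bound at the face's rate `ψ = Lb⁻²`. [folklore] -/
theorem psi_le_psiL : (LW ^ 2)⁻¹ ≤ ((Lb : ℝ) ^ 2)⁻¹ :=
  inv_anti₀ (pow_pos (natL_pos h81) 2) (pow_le_pow_left₀ (natL_pos h81).le (natL_le_LW h120) 2)

include h81 h120 in
/-- **BIRTH-DECAY DOMINATION** [arith]: `(LW⁻³)^K ≤ 1·(Lb⁻³)^{K−j}` — W7's birth amplitude decay at `τ = LW⁻³` is within the face's
dressing-envelope decay `β₀·(Lb⁻³)^{K−j}` with `β₀ = 1`, for every birth scale `j`. [folklore] -/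
theorem tau_pow_le (K j : ℕ) : (LW⁻¹ ^ 3) ^ K ≤ 1 * ((Lb : ℝ)⁻¹ ^ 3) ^ (K - j) := by
  have h0 : 0 ≤ LW⁻¹ := inv_nonneg.mpr LW_pos.le
  have h1 : LW⁻¹ ≤ (Lb : ℝ)⁻¹ := inv_anti₀ (natL_pos h81) (natL_le_LW h120)
  have h2 : (Lb : ℝ)⁻¹ ^ 3 ≤ 1 := pow_le_one₀ (inv_nonneg.mpr (natL_pos h81).le) (inv_le_one_of_one_le₀ (one_le_natL h81))
  have h3 : 0 ≤ (Lb : ℝ)⁻¹ ^ 3 := pow_nonneg (inv_nonneg.mpr (natL_pos h81).le) 3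
  rw [one_mul]
  calc (LW⁻¹ ^ 3) ^ K ≤ ((Lb : ℝ)⁻¹ ^ 3) ^ K := pow_le_pow_left₀ (pow_nonneg h0 3) (pow_le_pow_left₀ h0 h1 3) K
    _ ≤ ((Lb : ℝ)⁻¹ ^ 3) ^ (K - j) := pow_le_pow_of_le_one h3 h2 (Nat.sub_le K j)

include h81 in
/-- **THE LOCATED LARGENESS AT AN INTEGER OF THE WINDOW** [decided numeral]: `locCell Lb 2 0 ½ = 3e³∕Lb ≤ 3e³∕81 ≤ ¾`
(`e³ < 20.09`; `3·20.09 = 60.27 ≤ 60.75`). [folklore] -/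
theorem hloc_int : locCell (Lb : ℝ) (4 * (1 / 2) / 1) 0 (1 / 2) ≤ 3 / 4 := by
  unfold locCell alphaCell
  have h := exp_three_lt_20_09
  have hL : (81 : ℝ) ≤ Lb := by exact_mod_cast h81
  have hpos := natL_pos h81
  rw [show Real.exp 3 * (1 + 4 * (1 / 2)) / (Lb : ℝ) + (Lb : ℝ) * (4 * (1 / 2) / 1) * 0 = 3 * Real.exp 3 / Lb by ring,
    div_le_iff₀ hpos]
  nlinarith

/-- (w6) window at the reused dictionary constant, with EQUALITY: `m·(N₀A₀(1−ρ′)⁻¹) = ¼·(1·1·4) = 1 ≤ 1 − s̄⁰ = 1` — the dressed budget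
is exactly spent. [folklore] -/
theorem hsmall_int : (1 / 4 : ℝ) * (1 * 1 * (1 - 3 / 4)⁻¹) ≤ 1 - 0 := by norm_num

/-- [arith] [folklore] `¾ < 1`. -/ theorem hρ'_int : (3 / 4 : ℝ) < 1 := by norm_num
/-- [arith] [folklore] `v·mB = 1·1 ≤ N₀ = 1`. -/ theorem hvN₀_int : (((1 : ℕ) : ℝ)) * ((1 : ℕ) : ℝ) ≤ 1 := by norm_num
/-- [arith] [folklore] No absorption, no fan-out: `fanout 0 1 ¾ = 0 < 1`. -/
theorem hfan_int : fanout 0 1 (3 / 4) < 1 := by norm_num [fanout]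
/-- [arith] [folklore] The absorption fixed point is the dressing envelope's constant: `absorbAmplitude 1 0 1 ¾ = 1 ≤ A₀ = 1`. -/
theorem hamp_int : absorbAmplitude 1 0 1 (3 / 4) ≤ 1 := by norm_num [absorbAmplitude, fanout]

end IntegerWindow

/-- **NECESSITY — THE WINDOW OF THE CELL AT THE REUSED SCALARS** [arith]: with `κ = ½`, `C = 2`, `c̄ = 0`, the dictionary constant
`m = ¼` and `N₀, A₀ ≥ 1`, the located cell `locCell L 2 0 ½ ≤ ρ′ < 1` together with the (w6) window `¼·(N₀A₀(1−ρ′)⁻¹) ≤ 1 − s̄⁰`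
force `3e³ ≤ ρ′·L` and `1 ≤ 4·(1 − s̄⁰)·(1 − ρ′)`. [folklore] -/
theorem window_of_cell {L ρ' sbar N₀ A₀ : ℝ} (hL : 0 < L) (hN₀ : 1 ≤ N₀) (hA₀ : 1 ≤ A₀) (hρ' : ρ' < 1)
    (hloc : locCell L (4 * (1 / 2) / 1) 0 (1 / 2) ≤ ρ') (hsmall : 1 / 4 * (N₀ * A₀ * (1 - ρ')⁻¹) ≤ 1 - sbar) :
    3 * Real.exp 3 ≤ ρ' * L ∧ 1 ≤ 4 * (1 - sbar) * (1 - ρ') := by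
  unfold locCell alphaCell at hloc
  rw [show Real.exp 3 * (1 + 4 * (1 / 2)) / L + L * (4 * (1 / 2) / 1) * 0 = 3 * Real.exp 3 / L by ring,
    div_le_iff₀ hL] at hloc
  refine ⟨hloc, ?_⟩
  have h1ρ : 0 < 1 - ρ' := by linarith
  have hNA : 1 ≤ N₀ * A₀ := by nlinarith
  have hinv : (1 - ρ')⁻¹ ≤ N₀ * A₀ * (1 - ρ')⁻¹ :=
    le_mul_of_one_le_left (inv_nonneg.mpr h1ρ.le) hNA
  have h4 : (1 - ρ')⁻¹ ≤ 4 * (1 - sbar) := by linarith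
  have h5 : (1 - ρ')⁻¹ * (1 - ρ') = 1 := inv_mul_cancel₀ h1ρ.ne'
  nlinarith [mul_le_mul_of_nonneg_right h4 h1ρ.le]

/-- **EIGHTY BLOCKS PER SIDE ARE EXCLUDED** [decided numeral]: at the reused scalars NO `ρ′ < 1` and NO action margin `s̄⁰ ≥ 0` admit
the located cell at `L = 80` together with the (w6) window (`ρ′ ≤ ¾` against `3e³∕80 > ¾`, `e³ > 20.08`) — `81` is the least
blocking integer at which the canonical terminal face fires on W7's toy. [folklore] -/
theorem eighty_blocks_excluded {ρ' sbar N₀ A₀ : ℝ} (hN₀ : 1 ≤ N₀) (hA₀ : 1 ≤ A₀) (hs : 0 ≤ sbar) (hρ' : ρ' < 1)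
    (hloc : locCell 80 (4 * (1 / 2) / 1) 0 (1 / 2) ≤ ρ') (hsmall : 1 / 4 * (N₀ * A₀ * (1 - ρ')⁻¹) ≤ 1 - sbar) : False := by
  obtain ⟨h1, h2⟩ := window_of_cell (by norm_num) hN₀ hA₀ hρ' hloc hsmall
  have h3 := exp_three_gt_20_08
  nlinarith

/-- **THE NUMBER `s̄⁰ = ½` NEEDS THE CELL CONSTANT** [arith]: at the reused scalars an action margin `s̄⁰ = ½` (row W9's live action
exponent) forces `ρ′ ≤ ½` and `L ≥ 6e³ = LW` — no integer of the reuse window `L ≤ 120 < LW` carries it; recorded (LF-4), not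
repaired here: W9's data would have to be re-instantiated at rates `L⁻²` for an integer `L ≥ 121`. [folklore] -/
theorem half_margin_needs_LW {L ρ' N₀ A₀ : ℝ} (hL : 0 < L) (hN₀ : 1 ≤ N₀) (hA₀ : 1 ≤ A₀) (hρ' : ρ' < 1)
    (hloc : locCell L (4 * (1 / 2) / 1) 0 (1 / 2) ≤ ρ') (hsmall : 1 / 4 * (N₀ * A₀ * (1 - ρ')⁻¹) ≤ 1 - 1 / 2) : LW ≤ L := by
  obtain ⟨h1, h2⟩ := window_of_cell hL hN₀ hA₀ hρ' hloc hsmall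
  rw [LW_eq]
  have hρ'0 : ρ' ≤ 1 / 2 := by linarith
  nlinarith [Real.exp_pos 3]

/-! ## §2 The integer-`L` data on W7's booking: anchoring, housing, live families below the cutoff, absorption-free births
[decided toy] -/

/-- THE ANCHORING OF W7's BOOKING ON `ℕ⁴` WITH BLOCKING INTEGER `Lb` [decided toy]: the one localisation domain is the zero block,
every cube is centred at the zero block — which coarsens to itself under any number of `Lb`-fold blockings. [folklore] -/
def anchM (K Lb : ℕ) : Anchoring (BM K) 4 Lb where
  dom := fun _ => {0}
  center := fun _ => 0
  felt_under := fun _ _ _ => ⟨0, Finset.mem_singleton_self _, by funext i; simp [coarsen]⟩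

/-- Per-block multiplicity `mB = 1`: one family. [folklore] -/
theorem hmultM (K Lb : ℕ) : ∀ j (x : Fin 4 → ℕ),
    ((BM K).births.filter fun b => (BM K).birthScale b = j ∧ x ∈ (anchM K Lb).dom b).card ≤ 1 := by
  intro j x
  exact (Finset.card_filter_le _ _).trans (Finset.card_singleton ()).le

/-- Met components [decided toy]: the one cube of the current scale (none above the cutoff). [folklore] -/
def compM (K k : ℕ) (_b : (BM K).Birth) : Finset (Fin (K + 1)) :=
  if h : k ≤ K then {⟨k, Nat.lt_succ_of_le h⟩} else ∅

/-- The component's cube has the current scale. [folklore] -/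
theorem hscaleM (K : ℕ) : ∀ k b, ∀ q ∈ compM K k b, (BM K).cubeScale q = k := by
  intro k b q hq
  unfold compM at hq
  split_ifs at hq with h
  · rw [Finset.mem_singleton] at hq
    subst hq
    rfl
  · simp at hq

/-- Component volume `v = 1`. [folklore] -/
theorem hvolM (K : ℕ) : ∀ k b, (compM K k b).card ≤ 1 := by
  intro k b; unfold compM; split_ifs <;> simp

/-- Live families of a met component [decided toy]: the family itself AT AND BELOW THE CUTOFF, none above it (no cube lives above
`K`; W8's «none booked above the cutoff»). [folklore] -/
def SM (K k : ℕ) (b : (BM K).Birth) : Finset (BM K).Birth := if k ≤ K then {b} else ∅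

/-- Live generations [decided toy]: the family's own generation `0` at and below the cutoff (W7's `{(b,0)}`), none above. [folklore] -/
def SgM (K k : ℕ) (b : (BM K).Birth) : Finset ((BM K).Birth × ℕ) := if k ≤ K then {(b, 0)} else ∅

/-- The dictionary exponent [decided toy]: W7's LIVE `𝒬M K k` (`= ¼·a_K·z₀₀`) at and below the cutoff, `0` above it — so that the
dictionary `hQ` is an EQUATION at every `k` while the step law `hFn` (asked only for `k + 1 ≤ K`) is W7's `FnM_succ`. [folklore] -/
def 𝒬T (K k : ℕ) : Fld 4 ℂ → Fld 4 ℂ → ℂ := if k ≤ K then 𝒬M K k else zeroExp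

/-- [folklore] At and below the cutoff the live family is `{b}`. -/
theorem SM_of_le {K k : ℕ} (hk : k ≤ K) (b : (BM K).Birth) : SM K k b = {b} := if_pos hk
/-- [folklore] At and below the cutoff the live generation is `{(b,0)}`. -/
theorem SgM_of_le {K k : ℕ} (hk : k ≤ K) (b : (BM K).Birth) : SgM K k b = {(b, 0)} := if_pos hk
/-- [folklore] Above the cutoff nothing is live. -/
theorem SgM_of_not_le {K k : ℕ} (hk : ¬ k ≤ K) (b : (BM K).Birth) : SgM K k b = ∅ := if_neg hk
/-- [folklore] At and below the cutoff the dictionary exponent is W7's. -/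
theorem 𝒬T_of_le {K k : ℕ} (hk : k ≤ K) : 𝒬T K k = 𝒬M K k := if_pos hk
/-- [folklore] Above the cutoff the dictionary exponent vanishes. -/
theorem 𝒬T_of_not_le {K k : ℕ} (hk : ¬ k ≤ K) : 𝒬T K k = zeroExp := if_neg hk

/-- Live families are housed: the family is felt at the component's cube (L-C's `hhoused`). [folklore] -/
theorem hhousedM (K : ℕ) : ∀ k b, ∀ f ∈ SM K k b, ∃ q ∈ compM K k b, f ∈ (BM K).feltAt q := by
  intro k b f hf
  unfold SM at hf
  split_ifs at hf with hk
  · refine ⟨⟨k, Nat.lt_succ_of_le hk⟩, ?_, Finset.mem_singleton.mpr rfl⟩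
    unfold compM
    rw [dif_pos hk]
    exact Finset.mem_singleton_self _
  · simp at hf

/-- `hSg`: the live generation is a live family's, born, not from the future. [folklore] -/
theorem hSgT (K : ℕ) : ∀ (k : ℕ) (b : (BM K).Birth), ∀ p ∈ SgM K k b,
    p.1 ∈ SM K k b ∧ (BM K).birthScale p.1 ≤ p.2 ∧ p.2 ≤ k := by
  intro k b p hp
  by_cases hk : k ≤ K
  · rw [SgM_of_le hk, Finset.mem_singleton] at hp
    subst hp
    rw [SM_of_le hk]
    exact ⟨Finset.mem_singleton_self _, le_rfl, Nat.zero_le _⟩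
  · rw [SgM_of_not_le hk] at hp
    simp at hp

/-- THE DICTIONARY `hQ` AS AN EQUATION AT EVERY STEP [folklore]: at and below the cutoff W7's `hQM`; above it `0 = ¼·Σ_∅`. -/
theorem hQT (K : ℕ) (b : (BM K).Birth) (k : ℕ) :
    (fun U z => 𝒬T K k U z - (fun (_ : Fld 4 ℂ) => (0 : ℂ)) U) =
      fun U z => ((1 / 4 : ℝ) : ℂ) * ∑ p ∈ SgM K k b,
        (FnM K p.2 k (U + z) - FnM K p.2 k (U + (fun (_ : (BM K).Birth) (_ : ℕ) => (0 : Fld 4 ℂ)) b k)) := by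
  by_cases hk : k ≤ K
  · rw [𝒬T_of_le hk, SgM_of_le hk]
    exact hQM K b k
  · rw [𝒬T_of_not_le hk, SgM_of_not_le hk]
    funext U z
    simp [zeroExp]

/-- THE STEP LAW `hFn` AS AN EQUATION below the cutoff [folklore]: W7's `FnM_succ` (the guard `k + 1 ≤ K` puts `𝒬T K k = 𝒬M K k`). -/
theorem hFnT (K k' k : ℕ) (hk : k + 1 ≤ K) (U : Fld 4 ℂ) :
    FnM K k' (k + 1) U =
      wOp (expWeight base₁ (zeroExp + 𝒬T K k)) (flAt (atomW (k + 1))) 0 U (fun z => FnM K k' k (U + z)) := by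
  rw [𝒬T_of_le (Nat.le_of_succ_le hk)]
  exact FnM_succ K k' k U

section Rates

variable {Lb : ℕ} (h81 : 81 ≤ Lb) (h120 : Lb ≤ 120)
include h81 h120

/-- `hδf` (I4′) AT THE FACE's RATE `ψ = Lb⁻²` [folklore]: the fresh defect `LW^{−2(k+1)}∕4 ≤ ½·LW^{−2k} ≤ ½·Lb^{−2k}` (`hδfM` then
`psi_le_psiL`); vacuous above the cutoff. -/
theorem hδfT (K : ℕ) : ∀ (k : ℕ) (b : (BM K).Birth), ∀ p ∈ SgM K k b,
    0 ≤ dfW k ∧ dfW k ≤ 1 / 2 * (((Lb : ℝ) ^ 2)⁻¹) ^ (k - p.2) := by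
  intro k b p hp
  by_cases hk : k ≤ K
  · rw [SgM_of_le hk] at hp
    obtain ⟨h0, h1⟩ := hδfM K k b p hp
    exact ⟨h0, h1.trans (mul_le_mul_of_nonneg_left
      (pow_le_pow_left₀ psi_pos.le (psi_le_psiL h81 h120) _) (by norm_num))⟩
  · rw [SgM_of_not_le hk] at hp
    simp at hp

/-- `hrate` (I4′) AT THE FACE's RATE [folklore]: the transverse defect `½·LW^{−2(k+1)} ≤ ½·Lb^{−2(k−k′)}` (`hrateM` then `psi_le_psiL`). -/
theorem hrateT (k' k : ℕ) : defW (k + 1) ≤ 1 / 2 * (((Lb : ℝ) ^ 2)⁻¹) ^ (k - k') :=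
  (hrateM k' k).trans
    (mul_le_mul_of_nonneg_left (pow_le_pow_left₀ psi_pos.le (psi_le_psiL h81 h120) _) (by norm_num))

/-- `hβ` [folklore]: the dressing envelope `β K j := (LW⁻³)^K` is within `β₀·(Lb⁻³)^{K−j}`, `β₀ = 1` (`tau_pow_le`). -/
theorem hβT (K : ℕ) : ∀ j, j ≤ (BM K).K → (fun _ : ℕ => (LW⁻¹ ^ 3) ^ K) j ≤ 1 * ((Lb : ℝ)⁻¹ ^ 3) ^ ((BM K).K - j) :=
  fun j _ => tau_pow_le h81 h120 K j

end Rates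

/-- `habs` — ABSORPTION-FREE BIRTHS WITH EQUALITY [folklore]: `Sabs ≡ ∅`, `A = 0`, and `C·gen b 0 = 2·a_K·(c_M + 3) = (LW⁻³)^K = β K 0`
EXACTLY (W7's birth identity, `hbirthM`), for ANY rate profile and ANY gate. -/
theorem habsM (K : ℕ) (ρ : ℕ → ℝ) (Gate : ℕ → Prop) :
    (TM K).AbsorbsFrom (4 * (1 / 2) / 1) ρ (fun _ : ℕ => (LW⁻¹ ^ 3) ^ K) 0 (fun _ => ∅) Gate := by
  intro b _ _
  rw [Finset.sum_empty, mul_zero, add_zero]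
  show 4 * (1 / 2) / 1 * (if (0 : ℕ) = 0 then aM K * (cM + 3) else 0) ≤ (LW⁻¹ ^ 3) ^ K
  rw [if_pos rfl]
  have hc : 0 < cM + 3 := by linarith [cM_pos]
  unfold aM
  rw [show 4 * (1 / 2 : ℝ) / 1 * ((LW⁻¹ ^ 3) ^ K / (2 * (cM + 3)) * (cM + 3)) = (LW⁻¹ ^ 3) ^ K by field_simp; ring]

/-! ## §3 The booking convention on the affine functional: a bounded, attained increment set [folklore] -/

/-- **THE INCREMENT BOUND** [folklore]: for `rel := Eq`, an admissible pair `(U₀, U₁)` of defect `δ_{k+1}` is `U₁ = latMove U₀ p 1`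
with `latN p ≤ δ_{k+1}`, and the affine functional's increment is `a_K·‖p₀₀‖ ≤ a_K·δ_{k+1} = lin b 0 k` (later generations: `0 ≤ 0`)
— the realised-increment set of `hsup` is BOUNDED ABOVE by the booked size. -/
theorem osc_le (K : ℕ) (b : (BM K).Birth) (k' k : ℕ) {U₀ U₁ : Fld 4 ℂ}
    (h : RelGauge (fun U U' : Fld 4 ℂ => U = U') latMove latN U₀ U₁ (defW (k + 1))) :
    ‖FnM K k' k U₁ - FnM K k' k U₀‖ ≤ (TM K).lin b k' k := by
  obtain ⟨p, hp, hpδ, rfl⟩ := h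
  show _ ≤ (if k' = 0 then aM K * defW (k + 1) else 0)
  by_cases hk : k' = 0
  · subst hk
    simp only [FnM, ↓reduceIte, ev₀₀_latMove, one_mul]
    rw [show (aM K : ℂ) * (ev₀₀ U₀ + ev₀₀ p.1.1 + (shiftM K k : ℂ)) - (aM K : ℂ) * (ev₀₀ U₀ + (shiftM K k : ℂ)) =
        (aM K : ℂ) * ev₀₀ p.1.1 by ring,
      norm_mul, Complex.norm_real, Real.norm_eq_abs, abs_of_pos (aM_pos K)]
    exact mul_le_mul_of_nonneg_left ((norm_dir_le p 0 0).trans hpδ) (aM_pos K).le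
  · simp [FnM, hk]

/-- **THE INCREMENT IS ATTAINED** [folklore]: along W5's direction `dirW (k+1) = δ_{k+1}·e₀₀` from the base `0`, the increment IS the
booked size `a_K·δ_{k+1}` (the dressing cancels). -/
theorem osc_dirW (K : ℕ) (b : (BM K).Birth) (k' k : ℕ) :
    ‖FnM K k' k (latMove 0 (dirW (k + 1)) 1) - FnM K k' k 0‖ = (TM K).lin b k' k := by
  show _ = (if k' = 0 then aM K * defW (k + 1) else 0)
  by_cases hk : k' = 0
  · subst hk
    simp only [↓reduceIte, FnM, ev₀₀_move_dirW, ev₀₀_zero, zero_add]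
    rw [show (aM K : ℂ) * (((defW (k + 1) : ℝ) : ℂ) + (shiftM K k : ℂ)) - (aM K : ℂ) * (shiftM K k : ℂ) =
        ((aM K * defW (k + 1) : ℝ) : ℂ) by push_cast; ring,
      Complex.norm_real, Real.norm_eq_abs, abs_of_pos (mul_pos (aM_pos K) (defW_pos (k + 1)))]
  · simp [FnM, hk]

/-- `hne` — ADMISSIBLE PAIRS EXIST [folklore]: base `0` (in every window), gauge image along `dirW (k+1)` (defect `δ_{k+1}`), `rel := Eq`. -/
theorem hneM (k : ℕ) : ∃ U₀ ∈ (bondBall 4 (Wm.ρw k) : Set (Fld 4 ℂ)), ∃ U₁ : Fld 4 ℂ,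
    RelGauge (fun U U' : Fld 4 ℂ => U = U') latMove latN U₀ U₁ (defW (k + 1)) :=
  ⟨0, zero_mem_windowM k, latMove 0 (dirW (k + 1)) 1, ⟨dirW (k + 1), defW_pos (k + 1), le_rfl, rfl⟩⟩

/-- **`hsup` — THE BOOKED SIZE IS BELOW THE SUP OF THE REALISED INCREMENTS** (row S8's booking convention, stated with `Real.sSup`)
[folklore]: the realised-increment set is bounded above by the booked size (`osc_le`) and contains it (`osc_dirW`), so `lin ≤ sSup`
by `le_csSup` — no junk value: the set is nonempty AND bounded. -/
theorem hsupM (K : ℕ) (b : (BM K).Birth) (k' k : ℕ) :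
    (TM K).lin b k' k ≤ sSup {x : ℝ | ∃ U₀ ∈ (bondBall 4 (Wm.ρw k) : Set (Fld 4 ℂ)), ∃ U₁ : Fld 4 ℂ,
      RelGauge (fun U U' : Fld 4 ℂ => U = U') latMove latN U₀ U₁ (defW (k + 1)) ∧
        x = ‖FnM K k' k U₁ - FnM K k' k U₀‖} := by
  refine le_csSup ⟨(TM K).lin b k' k, fun x hx => ?_⟩
    ⟨0, zero_mem_windowM k, latMove 0 (dirW (k + 1)) 1, ⟨dirW (k + 1), defW_pos (k + 1), le_rfl, rfl⟩,
      (osc_dirW K b k' k).symm⟩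
  obtain ⟨U₀, _, U₁, hrel, rfl⟩ := hx
  exact osc_le K b k' k hrel

end Summit.QuantumFields.BalabanUV.T4Continuum.NE1p.DressedTerminalWitnessReuse

end
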